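import Summits.ResolutionOfSingularities.ResolutionOfSingularities.Theorems.FrobeniusClosingPatchingRelPerfectDepthPhaseCContactRealisation
import Literature.AlgebraicGeometry.Resolution.BlowupsIntegral
import Literature.AlgebraicGeometry.Resolution.NormalCrossingsLocal
import Literature.AlgebraicGeometry.Resolution.StalkIdealLemmas
import HarnessLib

/-!
# Crux `PatchingRelPerfect` (stmt-ResolutionOfSingularities-16161), chain W5.2 — F7(β) (β-AX) X3 C-I, (T-b′) CONTACT LEGALITY:
# along a `𝓑`-permissible sequence every centre lies over `Sing(closure X) ∪ (closure X ∩ B)`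

[OURS · L1 W5.2 · F7(β) (β-AX) X3 C-I (M2b-T) (T-b′) · res-L1-w52-plan-1 NOTE G12-46 (2), handed by res-D-repro-1 AS res-L1-repro-3 (20:39:31Z) to
res-D-pv-021 g9; same induction shape as repro-3΄s (T-b) `ContactRealisation.exists_centreSeq_of_isBPermissibleSequenceB` (p568017), with two more
invariants.]  Replaces the role of NO printed item; NOT a statement of the manuscript under review; fact-free.  AI-written; AI review is weaker
than expert review.  No definitions.

THE POINT.  CJS΄s `𝓑`-permissible sequences (`IsBPermissibleSequenceB X B σ X′ B′`, F-60΄s output shape) blow up centres `V(C) ⊆ closure X′`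
every point of which is a SINGULAR point of the strict transform `closure X′` or lies on the accumulated boundary `B′`.  For the LEGALITY
of the contact cure (the centres must lie over the cosupport) one needs this ON THE BASE: every centre of the realised `CentreSeq` lies over
`T₀ := Sing(closure X) ∪ (closure X ∩ B)`.  Two invariants carry it: `B′ ⊆ σ⁻¹(B ∪ T₀)` (the boundary is the old boundary plus exceptional
divisors over earlier — legal — centres) and «a singular point of `closure X′` OFF `B′` lies over a singular point of `closure X`» (off `B′`
no earlier centre lies below, so each blow-up is a local isomorphism there and the strict transform is locally the preimage:
`isRegularLocalRing_quot_strictTransform_iff`).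

* `isRegularLocalRing_quot_strictTransform_iff` — ONE STEP: for a blow-up `τ` along `C` and `z` with `τ z ∉ V(C)`,
  `𝒪_{Z″,z} ⧸ 𝓘(closure τ⁻¹(X′ ∖ V(C)))_z` is regular iff `𝒪_{Z′,τ z} ⧸ 𝓘(closure X′)_{τ z}` is.
* **`centresOver_singOrBoundary`** — the realisation `t` of repro-3΄s (T-b) (same construction) with, in addition, `t.CentresOver T₀`.

## References
* V. Cossart, U. Jannsen, S. Saito, *Desingularization: invariants and strategy* (2020), Def. 6.8 / (6.2), Thm. 6.9 (a). [CossartJannsenSaito2020]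
* U. Görtz, T. Wedhorn, *Algebraic Geometry I* (2nd ed., 2020), Prop. 13.91, (13.19) (blow-ups are isomorphisms off the centre; strict
  transform). [GortzWedhorn2020]
-/

-- `Summit.<Summit>.<Sub>.Theorems` with `Sub = Summit` (single-conjunct summit, D-0017)
set_option linter.dupNamespace false

noncomputable section

open CategoryTheory AlgebraicGeometry TopologicalSpace IsLocalRing
open Literature.AlgebraicGeometry.Resolution
open Scheme.IdealSheafData

namespace Summit.ResolutionOfSingularities.ResolutionOfSingularities.Theorems

namespace ContactRealisation

universe u

/-! ## §1 One step: regularity of the strict-transform quotient off the centre -/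

/-- Along a morphism inducing an isomorphism of local rings at `w`, the quotients by corresponding stalk ideals are isomorphic. [folklore] -/
theorem nonempty_ringEquiv_quot_of_isIso_stalkMap {V Y : Scheme.{u}} (f : V ⟶ Y) (I : Y.IdealSheafData) (w : V) [IsIso (f.stalkMap w)] :
    Nonempty (((Y.presheaf.stalk (f w)) ⧸ stalkIdeal I (f w)) ≃+* ((V.presheaf.stalk w) ⧸ stalkIdeal (I.comap f) w)) := by
  let e : Y.presheaf.stalk (f w) ≃+* V.presheaf.stalk w := (asIso (f.stalkMap w)).commRingCatIsoToRingEquiv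
  have he : (e : Y.presheaf.stalk (f w) →+* V.presheaf.stalk w) = (f.stalkMap w).hom := rfl
  refine ⟨Ideal.quotientEquiv _ _ e ?_⟩
  rw [stalkIdeal_comap_eq_map_stalkMap, ← he]

/-- **One blow-up does not change the singularities of the strict transform off the centre.**  For a blowing up `τ : Z″ → Z′` along `C`,
a subset `X′ ⊆ Z′` and a point `z` with `τ z ∉ V(C)`: the local ring of the strict transform `closure τ⁻¹(X′ ∖ V(C))` at `z` is regular iff
the local ring of `closure X′` at `τ z` is — `τ` is an open immersion off `V(C)` and there the strict transform is the preimage.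
[cite: GortzWedhorn2020, Prop. 13.91, (13.19)] -/
theorem isRegularLocalRing_quot_strictTransform_iff {Z' Z'' : Scheme.{u}} {τ : Z'' ⟶ Z'} {C : Z'.IdealSheafData} (hτ : IsBlowup τ C)
    (X' : Set Z') {z : Z''} (hz : τ z ∉ (C.support : Set Z')) :
    IsRegularLocalRing ((Z''.presheaf.stalk z) ⧸
        stalkIdeal (vanishingIdeal ⟨closure (τ ⁻¹' (X' \ (C.support : Set Z'))), isClosed_closure⟩) z) ↔
      IsRegularLocalRing ((Z'.presheaf.stalk (τ z)) ⧸ stalkIdeal (vanishingIdeal ⟨closure X', isClosed_closure⟩) (τ z)) := by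
  -- the open `W = τ⁻¹(Z′ ∖ V(C))` on which `τ` is an open immersion
  let W : Z''.Opens := τ ⁻¹ᵁ centreCompl C
  have hzW : z ∈ W := hz
  haveI : IsOpenImmersion (W.ι ≫ τ) := hτ.isOpenImmersion_preimage_compl_ι
  let w : (W : Scheme.{u}) := ⟨z, hzW⟩
  have hιw : W.ι w = z := rfl
  have hfw : (W.ι ≫ τ) w = τ z := rfl
  -- the strict transform and the preimage of `closure X′` agree on `W`
  have hsets : (⟨closure (τ ⁻¹' (X' \ (C.support : Set Z'))), isClosed_closure⟩ : Closeds Z'').preimage W.ι.continuous =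
      (⟨closure X', isClosed_closure⟩ : Closeds Z').preimage (W.ι ≫ τ).continuous := by
    ext v
    change W.ι v ∈ closure (τ ⁻¹' (X' \ (C.support : Set Z'))) ↔ (W.ι ≫ τ) v ∈ closure X'
    rw [← Set.mem_preimage, W.ι.isOpenEmbedding.isOpenMap.preimage_closure_eq_closure_preimage W.ι.continuous,
      ← Set.mem_preimage, (W.ι ≫ τ).isOpenEmbedding.isOpenMap.preimage_closure_eq_closure_preimage (W.ι ≫ τ).continuous]
    suffices h : W.ι ⁻¹' (τ ⁻¹' (X' \ (C.support : Set Z'))) = (W.ι ≫ τ) ⁻¹' X' by rw [h]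
    ext v
    simp only [Set.mem_preimage, Set.mem_sdiff, Scheme.Hom.comp_apply]
    exact ⟨fun h => h.1, fun h => ⟨h, v.2⟩⟩
  have hideal : (vanishingIdeal ⟨closure (τ ⁻¹' (X' \ (C.support : Set Z'))), isClosed_closure⟩).comap W.ι =
      (vanishingIdeal ⟨closure X', isClosed_closure⟩).comap (W.ι ≫ τ) := by
    rw [comap_vanishingIdeal_of_isOpenImmersion, comap_vanishingIdeal_of_isOpenImmersion, hsets]
  -- transport through the two isomorphisms of local rings at `w`
  obtain ⟨e₁⟩ := nonempty_ringEquiv_quot_of_isIso_stalkMap W.ι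
    (vanishingIdeal ⟨closure (τ ⁻¹' (X' \ (C.support : Set Z'))), isClosed_closure⟩) w
  obtain ⟨e₂⟩ := nonempty_ringEquiv_quot_of_isIso_stalkMap (W.ι ≫ τ) (vanishingIdeal ⟨closure X', isClosed_closure⟩) w
  rw [hideal] at e₁
  constructor
  · intro h
    haveI : IsRegularLocalRing ((Z''.presheaf.stalk (W.ι w)) ⧸
        stalkIdeal (vanishingIdeal ⟨closure (τ ⁻¹' (X' \ (C.support : Set Z'))), isClosed_closure⟩) (W.ι w)) := h
    exact IsRegularLocalRing.of_ringEquiv (e₁.trans e₂.symm)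
  · intro h
    haveI : IsRegularLocalRing ((Z'.presheaf.stalk ((W.ι ≫ τ) w)) ⧸
        stalkIdeal (vanishingIdeal ⟨closure X', isClosed_closure⟩) ((W.ι ≫ τ) w)) := h
    exact IsRegularLocalRing.of_ringEquiv (e₂.trans e₁.symm)

/-! ## §2 The legality invariant along a `𝓑`-permissible sequence -/

/-- **(T-b′) CONTACT LEGALITY.**  Along a `𝓑`-permissible sequence `(X, Z, B) ← … ← (X′, Z′, B′)` (CJS Def. 6.8 / Thm. 6.9 (a) shape):
(i) `X′ ⊆ σ⁻¹(closure X)`; (ii) `B′ ⊆ σ⁻¹(B ∪ T₀)`; (iii) a singular point of `closure X′` off `B′` lies over `T₀`; and (iv) repro-3΄s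
realisation `t` (a `CentreSeq` with `e : t.top ≅ Z′`, `e ≫ σ = t.comp`, regular centres over `closure X`) has moreover ALL CENTRES OVER
`T₀ := {z ∈ closure X | 𝒪_{Z,z} ⧸ 𝓘(closure X)_z is not regular} ∪ (closure X ∩ B)`.
[cite: CossartJannsenSaito2020, Def. 6.8 / (6.2), Thm. 6.9 (a)] [cite: GortzWedhorn2020, Prop. 13.91] -/
theorem centresOver_singOrBoundary {Z : Scheme.{u}} {X B : Set Z} {Z' : Scheme.{u}} {σ : Z' ⟶ Z} {X' B' : Set Z'}
    (h : IsBPermissibleSequenceB X B σ X' B') :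
    X' ⊆ σ ⁻¹' closure X ∧
    B' ⊆ σ ⁻¹' (B ∪ ({z | z ∈ closure X ∧ ¬ IsRegularLocalRing ((Z.presheaf.stalk z) ⧸
        stalkIdeal (vanishingIdeal ⟨closure X, isClosed_closure⟩) z)} ∪ (closure X ∩ B))) ∧
    (∀ z : Z', z ∉ B' → z ∈ closure X' →
      ¬ IsRegularLocalRing ((Z'.presheaf.stalk z) ⧸ stalkIdeal (vanishingIdeal ⟨closure X', isClosed_closure⟩) z) →
      σ z ∈ {z | z ∈ closure X ∧ ¬ IsRegularLocalRing ((Z.presheaf.stalk z) ⧸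
        stalkIdeal (vanishingIdeal ⟨closure X, isClosed_closure⟩) z)} ∪ (closure X ∩ B)) ∧
    ∃ (t : CentreSeq Z) (e : t.top ≅ Z'), e.hom ≫ σ = t.comp ∧ t.AllRegular ∧ t.CentresOver (closure X) ∧
      t.CentresOver ({z | z ∈ closure X ∧ ¬ IsRegularLocalRing ((Z.presheaf.stalk z) ⧸
        stalkIdeal (vanishingIdeal ⟨closure X, isClosed_closure⟩) z)} ∪ (closure X ∩ B)) := by
  classical
  induction h with
  | refl =>
    refine ⟨subset_closure, ?_, ?_, CentreSeq.nil Z, Iso.refl Z, by simp, trivial, trivial, trivial⟩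
    · intro z hz
      exact Or.inl hz
    · intro z _ hzX hsing
      exact Or.inl ⟨hzX, hsing⟩
  | @blowup Z' Z'' σ X' B' _ C τ hτ hreg hsub hBsing _ _ ih =>
    obtain ⟨hX', hB', hS', t, e, he, hreg_t, hover, hoverT⟩ := ih
    -- the strict transform bound: `closure X′ ⊆ σ⁻¹(closure X)`
    have hcl : closure X' ⊆ σ ⁻¹' closure X := closure_minimal hX' (isClosed_closure.preimage σ.continuous)
    -- THE CENTRE CONDITION: every point of `V(C)` lies over `T₀`
    have hcentre : ∀ x ∈ (C.support : Set Z'), σ x ∈ {z | z ∈ closure X ∧ ¬ IsRegularLocalRing ((Z.presheaf.stalk z) ⧸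
        stalkIdeal (vanishingIdeal ⟨closure X, isClosed_closure⟩) z)} ∪ (closure X ∩ B) := by
      intro x hx
      have hxX' : x ∈ closure X' := by
        have h3 := support_antitone hsub hx
        rwa [← SetLike.mem_coe, Scheme.IdealSheafData.coe_support_vanishingIdeal] at h3
      have hσx : σ x ∈ closure X := hcl hxX'
      by_cases hxB : x ∈ B'
      · rcases hB' hxB with h1 | h1
        · exact Or.inr ⟨hσx, h1⟩
        · exact h1
      · rcases hBsing x hx with h1 | h1
        · exact hS' x hxB hxX' h1
        · exact absurd h1 hxB
    -- the transported centre on the top of `t`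
    have hC'reg : Scheme.IsRegular (C.comap e.hom).subscheme := isRegular_subscheme_comap_of_isOpenImmersion e.hom C hreg
    obtain ⟨f, hf, -⟩ := (isBlowup_π_comp_iso e C).unique hτ
    refine ⟨?_, ?_, ?_, t.append (CentreSeq.single (C.comap e.hom)), (eqToIso (CentreSeq.top_append t _)).trans f, ?_, ?_, ?_, ?_⟩
    · -- (i) the new strict transform lies over `closure X`
      refine closure_minimal (fun z hz => ?_) (isClosed_closure.preimage (τ ≫ σ).continuous)
      show (τ ≫ σ) z ∈ closure X
      rw [Scheme.Hom.comp_apply]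
      exact hX' hz.1
    · -- (ii) the new boundary `τ⁻¹(B′ ∪ V(C))` lies over `B ∪ T₀`
      intro z hz
      rw [Set.mem_preimage, Scheme.Hom.comp_apply]
      rcases hz with h1 | h1
      · exact hB' h1
      · exact Or.inr (hcentre _ h1)
    · -- (iii) singular points of the new strict transform off the new boundary
      intro z hzB hzX hsing
      have hcc : (⟨closure (closure (τ ⁻¹' (X' \ (C.support : Set Z')))), isClosed_closure⟩ : Closeds Z'') =
          ⟨closure (τ ⁻¹' (X' \ (C.support : Set Z'))), isClosed_closure⟩ := Closeds.ext closure_closure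
      rw [hcc] at hsing
      rw [closure_closure] at hzX
      have hτzB : τ z ∉ B' := fun h1 => hzB (Or.inl h1)
      have hτzC : τ z ∉ (C.support : Set Z') := fun h1 => hzB (Or.inr h1)
      have hτzX : τ z ∈ closure X' := by
        have h1 : closure (τ ⁻¹' (X' \ (C.support : Set Z'))) ⊆ τ ⁻¹' closure X' :=
          closure_minimal (fun y hy => subset_closure hy.1) (isClosed_closure.preimage τ.continuous)
        exact h1 hzX
      rw [Scheme.Hom.comp_apply]
      exact hS' (τ z) hτzB hτzX (fun hreg' => hsing ((isRegularLocalRing_quot_strictTransform_iff hτ X' hτzC).mpr hreg'))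
    · -- the equation `e′ ≫ (τ ≫ σ) = (t ⧺ [C′]).comp`
      rw [Iso.trans_hom, eqToIso.hom, Category.assoc, CentreSeq.comp_append, CentreSeq.comp_single, Category.id_comp]
      erw [reassoc_of% hf, he]
      rfl
    · exact (CentreSeq.allRegular_append_iff t _).mpr ⟨hreg_t, hC'reg, trivial⟩
    · refine (CentreSeq.centresOver_append_iff t _ _).mpr ⟨hover, fun y hy => ?_, trivial⟩
      rw [Scheme.IdealSheafData.support_comap] at hy
      have h1 : e.hom y ∈ (C.support : Set Z') := hy
      have h2 : e.hom y ∈ closure X' := by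
        have h3 := support_antitone hsub h1
        rwa [← SetLike.mem_coe, Scheme.IdealSheafData.coe_support_vanishingIdeal] at h3
      show t.comp y ∈ closure X
      rw [← he, Scheme.Hom.comp_apply]
      exact hcl h2
    · -- ALL CENTRES OVER `T₀`
      refine (CentreSeq.centresOver_append_iff t _ _).mpr ⟨hoverT, fun y hy => ?_, trivial⟩
      rw [Scheme.IdealSheafData.support_comap] at hy
      have h1 : e.hom y ∈ (C.support : Set Z') := hy
      rw [Set.mem_preimage, ← he, Scheme.Hom.comp_apply]
      exact hcentre _ h1

end ContactRealisation

end Summit.ResolutionOfSingularities.ResolutionOfSingularities.Theorems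

end
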